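import Mathlib
import Summits.ABC.ABC.Statement
import Literature.NumberTheory.DiophantineGeometry.AbcImpliesHall

/-!
# The Roth / Thue face of `abc`: the polynomial rungs, place by place (solo-ABC-informed, s18)

On the thin family of abc triples `(a qᵈ, n, pᵈ)` coming from a Thue equation
`pᵈ − a qᵈ = ± n` (`p/q` a rational approximation to `a^{1/d}`), the radical is at least
`p q ≫_a c^{2/d}` for free, so every such triple satisfies the POLYNOMIAL abc bound
`c ≤ K_a · rad(abc)^{d/2}` trivially (this is Liouville's inequality), and the conjecture `ABC`
asks for the exponent `1 + ε` in place of `d/2`, uniformly in `a` and `d`: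

* `soloInformed_thue_of_abc` : `ABC → ∀ ε > 0 ∃ C ∀ d a p q n`, `gcd(p, q) = gcd(p, a) = 1`,
  `pᵈ − a qᵈ = ± n ≠ 0` ⟹ `max(pᵈ, a qᵈ) < C · (rad(a) · p · q · n)^{1+ε}`.
  In words: the Thue inequality `|pᵈ − a qᵈ| ≫ q^{d − 2 − ε'}` with a constant `C(ε)·rad(a)^{O(1)}`
  — Roth's exponent `2 + ε'` for every `a^{1/d}` at once (the pure-power case of
  Bombieri–Gubler, *Heights*, Thm. 12.2.9 / 12.2.12, pp. 398–400, where the general algebraic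
  number needs Belyĭ's lemma; Remark 12.2.10, p. 399: an effective `abc` gives an effective Roth).
* `soloInformed_thue_of_polynomialABC` : Oesterlé's polynomial abc with exponent `M`
  (`c ≤ K · rad^M`, the rung `(W)` of `SoloInformedWall`) gives the same with exponent `M`:
  non-trivial on the degree-`d` face exactly when `M < d/2`, i.e. an EFFECTIVE `(W)` with exponent
  `M` is an effective improvement `κ = d + 2 − d/M < d` of Liouville's exponent for every `a^{1/d}`
  with `d > 2M`, uniformly in `a`.

What is known effectively on this face (archimedean place only — no `p`-adic logarithm enters):
`κ = d − τ`, `τ = (3^{d+26} d^{15d+20} R log max(e,R))⁻¹` with `R` the regulator of `ℚ(a^{1/d})`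
(Feldman; Bugeaud–Győry), cube roots `κ = 3 − 1/(10¹² log ε_a)` (Baker–Stewart 1988, Thm 1), and
`κ(2^{1/3}) = 2.955` (Baker 1964), `≈ 2.43` (Chudnovsky 1983) by the hypergeometric method at the
anchored radicands only ("`5^{1/3}` is the smallest cube root not covered", Baker–Stewart p. 10).
So the polynomial rungs `M < 3/2` already fail at the archimedean place, by the regulator.
[cite: BombieriGubler2006, Thm 12.2.9, Rem 12.2.10, Thm 12.2.12, pp.398-400]
-/

namespace Summit.ABC.ABC.Theorems

open Literature.NumberTheory.DiophantineGeometry UniqueFactorizationMonoid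

/-- The radical of a Thue triple: `rad(a qᵈ · n · pᵈ) ≤ rad(a) · p · q · n`. [folklore] -/
theorem soloInformed_rad_thue_le {a p q n d : ℕ} (hp : 0 < p) (hq : 0 < q) (hn : 0 < n) :
    rad (a * q ^ d) n (p ^ d) ≤ radical a * p * q * n := by
  rw [rad_def]
  have h1 : radical (a * q ^ d) ≤ radical a * q := by
    have hd : radical (a * q ^ d) ∣ radical a * radical (q ^ d) := radical_mul_dvd
    calc radical (a * q ^ d) ≤ radical a * radical (q ^ d) :=
          Nat.le_of_dvd (mul_pos (Nat.radical_pos _) (Nat.radical_pos _)) hd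
      _ ≤ radical a * q := by
          gcongr
          exact radical_le_of_dvd_pow hq.ne' (dvd_refl _)
  calc radical (a * q ^ d * n * p ^ d)
        ≤ radical (a * q ^ d) * radical n * radical (p ^ d) := radical_mul_three_le _ _ _
    _ ≤ (radical a * q) * n * p := by
        gcongr
        · exact Nat.radical_le_self_iff.mpr hn.ne'
        · exact radical_le_of_dvd_pow hp.ne' (dvd_refl _)
    _ = radical a * p * q * n := by ring

/-- The same bound for the triple written in the other order `(pᵈ, n, a qᵈ)`. [folklore] -/
theorem soloInformed_rad_thue_le' {a p q n d : ℕ} (hp : 0 < p) (hq : 0 < q) (hn : 0 < n) :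
    rad (p ^ d) n (a * q ^ d) ≤ radical a * p * q * n := by
  have h := soloInformed_rad_thue_le (a := a) (d := d) hp hq hn
  rw [rad_def] at h ⊢
  calc radical (p ^ d * n * (a * q ^ d)) = radical (a * q ^ d * n * p ^ d) := by ring_nf
    _ ≤ radical a * p * q * n := h

/-- `gcd(p, q) = gcd(p, a) = 1` makes `pᵈ` and `a qᵈ` coprime. [folklore] -/
theorem soloInformed_coprime_thue {a p q d : ℕ} (hpq : Nat.Coprime p q) (hpa : Nat.Coprime p a) :
    Nat.Coprime (p ^ d) (a * q ^ d) :=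
  Nat.Coprime.mul_right (Nat.Coprime.pow_left d hpa) (Nat.Coprime.pow d d hpq)

/-- Upper approximations: `a qᵈ + n = pᵈ` with the coprimality gives the abc triple `(a qᵈ, n, pᵈ)`.
[folklore] -/
theorem soloInformed_isABCTriple_thue_upper {a p q n d : ℕ} (hq : 0 < q) (ha : 0 < a) (hn : 0 < n)
    (hpq : Nat.Coprime p q) (hpa : Nat.Coprime p a) (h : a * q ^ d + n = p ^ d) :
    IsABCTriple (a * q ^ d) n (p ^ d) := by
  refine ⟨by positivity, hn, h, ?_⟩
  have hc : Nat.Coprime (a * q ^ d) (p ^ d) := (soloInformed_coprime_thue (d := d) hpq hpa).symm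
  rw [← h, Nat.coprime_self_add_right] at hc
  exact hc

/-- Lower approximations: `pᵈ + n = a qᵈ` gives the abc triple `(pᵈ, n, a qᵈ)`. [folklore] -/
theorem soloInformed_isABCTriple_thue_lower {a p q n d : ℕ} (hp : 0 < p) (hn : 0 < n)
    (hpq : Nat.Coprime p q) (hpa : Nat.Coprime p a) (h : p ^ d + n = a * q ^ d) :
    IsABCTriple (p ^ d) n (a * q ^ d) := by
  refine ⟨by positivity, hn, h, ?_⟩
  have hc : Nat.Coprime (p ^ d) (a * q ^ d) := soloInformed_coprime_thue (d := d) hpq hpa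
  rw [← h, Nat.coprime_self_add_right] at hc
  exact hc

/-- **The Thue face of abc (Roth's exponent for all `a^{1/d}` at once).** `ABC` gives, for every
`ε > 0`, one constant `C` such that `max(pᵈ, a qᵈ) < C · (rad(a) p q n)^{1+ε}` whenever
`pᵈ − a qᵈ = ± n ≠ 0` with `gcd(p,q) = gcd(p,a) = 1`; i.e. `|pᵈ − a qᵈ| ≫_ε q^{d−2−dε/(1+ε)}·(…)`,
the pure-power case of Bombieri–Gubler Thm 12.2.12, uniformly in `a` and `d`.
[cite: BombieriGubler2006, Thm 12.2.12 p.400] -/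
theorem soloInformed_thue_of_abc (habc : _root_.ABC) :
    ∀ ε : ℝ, 0 < ε → ∃ C : ℝ, 0 < C ∧ ∀ d a p q n : ℕ, 0 < p → 0 < q → 0 < a → 0 < n →
      Nat.Coprime p q → Nat.Coprime p a → (p ^ d = a * q ^ d + n ∨ a * q ^ d = p ^ d + n) →
        ((p ^ d : ℕ) : ℝ) < C * (((radical a * p * q * n : ℕ) : ℝ)) ^ (1 + ε) ∧
        ((a * q ^ d : ℕ) : ℝ) < C * (((radical a * p * q * n : ℕ) : ℝ)) ^ (1 + ε) := by
  intro ε hε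
  obtain ⟨C, hC, hC'⟩ := (_root_.ABC_iff.mp habc) ε hε
  refine ⟨C, hC, fun d a p q n hp hq ha hn hpq hpa h => ?_⟩
  have hε1 : (0 : ℝ) ≤ 1 + ε := by linarith
  rcases h with h | h
  · -- upper approximation: (a q^d, n, p^d)
    have ht := soloInformed_isABCTriple_thue_upper (d := d) hq ha hn hpq hpa h.symm
    have hlt := hC' _ _ _ ht
    have hr : ((rad (a * q ^ d) n (p ^ d) : ℕ) : ℝ) ≤ ((radical a * p * q * n : ℕ) : ℝ) := by
      exact_mod_cast soloInformed_rad_thue_le (a := a) (d := d) hp hq hn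
    have hmono : C * ((rad (a * q ^ d) n (p ^ d) : ℕ) : ℝ) ^ (1 + ε) ≤
        C * ((radical a * p * q * n : ℕ) : ℝ) ^ (1 + ε) := by
      gcongr
    have h1 : ((p ^ d : ℕ) : ℝ) < C * ((radical a * p * q * n : ℕ) : ℝ) ^ (1 + ε) :=
      lt_of_lt_of_le hlt hmono
    have h2 : ((a * q ^ d : ℕ) : ℝ) ≤ ((p ^ d : ℕ) : ℝ) := by exact_mod_cast (by omega : a * q ^ d ≤ p ^ d)
    exact ⟨h1, lt_of_le_of_lt h2 h1⟩
  · -- lower approximation: (p^d, n, a q^d)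
    have ht := soloInformed_isABCTriple_thue_lower (d := d) hp hn hpq hpa h.symm
    have hlt := hC' _ _ _ ht
    have hr : ((rad (p ^ d) n (a * q ^ d) : ℕ) : ℝ) ≤ ((radical a * p * q * n : ℕ) : ℝ) := by
      exact_mod_cast soloInformed_rad_thue_le' (a := a) (d := d) hp hq hn
    have hmono : C * ((rad (p ^ d) n (a * q ^ d) : ℕ) : ℝ) ^ (1 + ε) ≤
        C * ((radical a * p * q * n : ℕ) : ℝ) ^ (1 + ε) := by
      gcongr
    have h1 : ((a * q ^ d : ℕ) : ℝ) < C * ((radical a * p * q * n : ℕ) : ℝ) ^ (1 + ε) :=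
      lt_of_lt_of_le hlt hmono
    have h2 : ((p ^ d : ℕ) : ℝ) ≤ ((a * q ^ d : ℕ) : ℝ) := by exact_mod_cast (by omega : p ^ d ≤ a * q ^ d)
    exact ⟨lt_of_le_of_lt h2 h1, h1⟩

/-- **The Thue face of polynomial abc.** Oesterlé's `(W)`: `c ≤ K · rad^M` gives
`max(pᵈ, a qᵈ) ≤ K · (rad(a) p q n)^M` on the same family — an effective improvement of Liouville's
exponent for every `a^{1/d}` with `d > 2M` (`|a^{1/d} − p/q| ≫ q^{−(d + 2 − d/M)}`), uniformly in `a`.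
Effectively known instead: `κ = d − τ(a, d)` with `τ⁻¹ = 3^{d+26} d^{15d+20}·R·log max(e, R)`,
`R` the regulator of `ℚ(a^{1/d})` (Feldman's theorem in Bugeaud–Győry's form). [folklore] -/
theorem soloInformed_thue_of_polynomialABC
    (hW : ∃ M : ℕ, ∃ K : ℝ, 0 < K ∧
      ∀ a b c : ℕ, IsABCTriple a b c → (c : ℝ) ≤ K * ((rad a b c : ℕ) : ℝ) ^ M) :
    ∃ M : ℕ, ∃ K : ℝ, 0 < K ∧ ∀ d a p q n : ℕ, 0 < p → 0 < q → 0 < a → 0 < n →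
      Nat.Coprime p q → Nat.Coprime p a → (p ^ d = a * q ^ d + n ∨ a * q ^ d = p ^ d + n) →
        ((p ^ d : ℕ) : ℝ) ≤ K * (((radical a * p * q * n : ℕ) : ℝ)) ^ M ∧
        ((a * q ^ d : ℕ) : ℝ) ≤ K * (((radical a * p * q * n : ℕ) : ℝ)) ^ M := by
  obtain ⟨M, K, hK, hK'⟩ := hW
  refine ⟨M, K, hK, fun d a p q n hp hq ha hn hpq hpa h => ?_⟩
  rcases h with h | h
  · have ht := soloInformed_isABCTriple_thue_upper (d := d) hq ha hn hpq hpa h.symm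
    have hle := hK' _ _ _ ht
    have hr : ((rad (a * q ^ d) n (p ^ d) : ℕ) : ℝ) ≤ ((radical a * p * q * n : ℕ) : ℝ) := by
      exact_mod_cast soloInformed_rad_thue_le (a := a) (d := d) hp hq hn
    have hmono : K * ((rad (a * q ^ d) n (p ^ d) : ℕ) : ℝ) ^ M ≤
        K * ((radical a * p * q * n : ℕ) : ℝ) ^ M := by
      gcongr
    have h1 : ((p ^ d : ℕ) : ℝ) ≤ K * ((radical a * p * q * n : ℕ) : ℝ) ^ M := hle.trans hmono
    have h2 : ((a * q ^ d : ℕ) : ℝ) ≤ ((p ^ d : ℕ) : ℝ) := by exact_mod_cast (by omega : a * q ^ d ≤ p ^ d)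
    exact ⟨h1, h2.trans h1⟩
  · have ht := soloInformed_isABCTriple_thue_lower (d := d) hp hn hpq hpa h.symm
    have hle := hK' _ _ _ ht
    have hr : ((rad (p ^ d) n (a * q ^ d) : ℕ) : ℝ) ≤ ((radical a * p * q * n : ℕ) : ℝ) := by
      exact_mod_cast soloInformed_rad_thue_le' (a := a) (d := d) hp hq hn
    have hmono : K * ((rad (p ^ d) n (a * q ^ d) : ℕ) : ℝ) ^ M ≤
        K * ((radical a * p * q * n : ℕ) : ℝ) ^ M := by
      gcongr
    have h1 : ((a * q ^ d : ℕ) : ℝ) ≤ K * ((radical a * p * q * n : ℕ) : ℝ) ^ M := hle.trans hmono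
    have h2 : ((p ^ d : ℕ) : ℝ) ≤ ((a * q ^ d : ℕ) : ℝ) := by exact_mod_cast (by omega : p ^ d ≤ a * q ^ d)
    exact ⟨h2.trans h1, h1⟩

/-- **Liouville for free on this face.** A Thue triple with `d ≥ 2` satisfies polynomial abc with
exponent `d/2` and constant `2a` unconditionally: `max(pᵈ, a qᵈ)² ≤ 4a² · (rad(a) p q n)ᵈ`
(if `n ≤ min` then `max ≤ 2 min` and `max · min = a (pq)ᵈ`; else `max < 2n ≤ 2 n^{d/2}`). So the face
lives inside the polynomial regime `c ≤ K_a · rad(abc)^{d/2}`; `abc` is the statement that the exponent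
drops from `d/2` (Liouville) to `1 + ε` with `K_a ≤ C(ε) rad(a)^{1+ε}`. [folklore] -/
theorem soloInformed_thue_liouville_free {a p q n d : ℕ} (hp : 0 < p) (hq : 0 < q) (ha : 0 < a)
    (hn : 0 < n) (hd : 2 ≤ d) (h : p ^ d = a * q ^ d + n ∨ a * q ^ d = p ^ d + n) :
    (max (p ^ d) (a * q ^ d)) ^ 2 ≤ 4 * a ^ 2 * (radical a * p * q * n) ^ d := by
  have hra : 1 ≤ radical a := Nat.radical_pos a
  -- the two generic comparisons
  have hpq : (p * q) ^ d ≤ (radical a * p * q * n) ^ d := by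
    apply Nat.pow_le_pow_left
    calc p * q = 1 * (p * q) * 1 := by ring
      _ ≤ radical a * (p * q) * n := by (gcongr; omega)
      _ = radical a * p * q * n := by ring
  have hnd : n ^ 2 ≤ (radical a * p * q * n) ^ d := by
    calc n ^ 2 ≤ n ^ d := Nat.pow_le_pow_right hn hd
      _ ≤ (radical a * p * q * n) ^ d := by
          apply Nat.pow_le_pow_left
          calc n = 1 * n := (one_mul n).symm
            _ ≤ (radical a * p * q) * n := by
                gcongr; exact Nat.one_le_iff_ne_zero.mpr (by positivity)
  have ha2 : 2 * a ≤ 4 * a ^ 2 := by nlinarith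
  have ha4 : 4 ≤ 4 * a ^ 2 := by nlinarith
  have hprod : p ^ d * (a * q ^ d) = a * (p * q) ^ d := by rw [mul_pow]; ring
  rcases h with h | h
  · -- max = p^d
    have hmax : max (p ^ d) (a * q ^ d) = p ^ d := max_eq_left (by omega)
    rw [hmax]
    by_cases hc : n ≤ a * q ^ d
    · -- p^d ≤ 2 a q^d
      have h1 : p ^ d ≤ 2 * (a * q ^ d) := by omega
      calc (p ^ d) ^ 2 = p ^ d * p ^ d := by ring
        _ ≤ p ^ d * (2 * (a * q ^ d)) := by gcongr
        _ = 2 * a * (p * q) ^ d := by rw [mul_pow]; ring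
        _ ≤ 2 * a * (radical a * p * q * n) ^ d := by gcongr
        _ ≤ 4 * a ^ 2 * (radical a * p * q * n) ^ d := by gcongr
    · have h1 : p ^ d < 2 * n := by omega
      calc (p ^ d) ^ 2 ≤ (2 * n) ^ 2 := Nat.pow_le_pow_left h1.le 2
        _ = 4 * n ^ 2 := by ring
        _ ≤ 4 * (radical a * p * q * n) ^ d := by gcongr
        _ ≤ 4 * a ^ 2 * (radical a * p * q * n) ^ d := by gcongr
  · -- max = a q^d
    have hmax : max (p ^ d) (a * q ^ d) = a * q ^ d := max_eq_right (by omega)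
    rw [hmax]
    by_cases hc : n ≤ p ^ d
    · have h1 : a * q ^ d ≤ 2 * p ^ d := by omega
      calc (a * q ^ d) ^ 2 = (a * q ^ d) * (a * q ^ d) := by ring
        _ ≤ (2 * p ^ d) * (a * q ^ d) := by gcongr
        _ = 2 * a * (p * q) ^ d := by rw [mul_pow]; ring
        _ ≤ 2 * a * (radical a * p * q * n) ^ d := by gcongr
        _ ≤ 4 * a ^ 2 * (radical a * p * q * n) ^ d := by gcongr
    · have h1 : a * q ^ d < 2 * n := by omega
      calc (a * q ^ d) ^ 2 ≤ (2 * n) ^ 2 := Nat.pow_le_pow_left h1.le 2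
        _ = 4 * n ^ 2 := by ring
        _ ≤ 4 * (radical a * p * q * n) ^ d := by gcongr
        _ ≤ 4 * a ^ 2 * (radical a * p * q * n) ^ d := by gcongr

end Summit.ABC.ABC.Theorems
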